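import Summits.BirchSwinnertonDyer.BirchSwinnertonDyer.Theorems.EisensteinPrimesMazurMCOnCellBMuPartTightParity
import Summits.BirchSwinnertonDyer.BirchSwinnertonDyer.Theorems.SchneiderAtThreeInvolOrderParity
import Summits.BirchSwinnertonDyer.Rank1Residual.X2.RankOneHeegnerExact
import Literature.NumberTheory.EllipticCurves.Greenberg1999.CharIdealInvolutionIdealForm
import HarnessLib

/-!
# Crux `MazurMCOnCellB` (stmt-BirchSwinnertonDyer-19033), line `mudescent` v4 — the PARITY INPUT of the
# μ-tolerant parity route T from Greenberg's Thm. 1.14 (ι-invariance of `char X`) instead of Prop. 3.10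

LEAD bsd-line-x2-p1 g3 (2026-08-28). Skeleton v4 (sha256 `460ece00…`) carries two FACT-grade stubs:
stub 1 `EisensteinPrimes.PublishedInputs` and stub 1b `Greenberg1999.prop310_selmerCorank_mod_two_eq_lambdaInvariant`
(Greenberg, LNM 1716, Prop. 3.10, cite-only, size XL: Cassels–Tate/Flach on every layer + Guo's lemma).
Stub 1b is consumed at ONE point: the parity `λ(X(W₀/ℚ_∞)) ≡ r_an(W₀) = 0 (mod 2)` at the X2b étale end,
inside `…MuPartTightParity.mazurMainConjectureAt_of_muPart_of_lambdaCountParity`. THIS FILE derives that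
parity on X2b from stub 1 plus Greenberg's **Thm. 1.14** ("the characteristic ideal of `X_E(F_∞)` is
fixed by the involution `ι`"; tree named fact `Greenberg1999_thm114_charIdeal_iota_invariant`, already
the currency of LINE 9 on crux `SchneiderAtThree` and of the X5 `2`-adic doors), by KERNEL algebra only:

* §1 `order_eq_zero_of_analyticRank_eq_zero`: at an odd multiplicative `p` with `r_an = 0` every
  generator `f_E` of `char_Λ X` has `ord_{T=0} f_E = 0` — GZK (rank `0`, `Ш` finite) + Stein–Wuthrich
  2013 Thm. 6.1 clause (2) (split / non-split, THE §4.2 height from the existence facts) + `Reg_p = 1`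
  in rank `0` (`padicRegulator_eq_one_of_finite`); conjuncts 11, 16–19 of `PublishedInputs`.
* §2 `even_lambdaInvariant_of_analyticRank_eq_zero_of_thm114`: adding Thm. 1.14, `λ(X)` is EVEN for
  every cyclotomic torsion dual datum (`p ≠ 2`): `ι(char X) = char X`
  (`Greenberg1999.map_invol_charIdeal_eq_of_thm114`) forces `ord_T f_E ≡ λ(X) (mod 2)`
  (`order_mod_two_eq_lambdaInvariant_of_map_invol_eq`), and §1. Corollary: LITERALLY Prop. 3.10's
  conclusion `corank % 2 = λ % 2` at every such pair (`selmerCorank_mod_two_eq_lambdaInvariant_mod_two_of_thm114`).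
* §3 `mazurMainConjectureAt_of_muPart_of_lambdaCountParity_of_algParity`: the μ-tolerant parity route T
  of `…MuPartTightParity` with `h310` + `hGZK` replaced by ONE abstract per-datum parity hypothesis
  `λ(X) ≡ r_an (mod 2)` (proof adapted verbatim; Wuthrich Thm. 16 the only named fact left).
* §4 `mazurMainConjectureAt_of_muPart_of_lambdaCountWeak_of_thm114` and the X2b iff
  `cellB_mazurMainConjectureAt_iff_muPart_and_lambdaCountWeak_of_thm114`: the v4 currency of the line
  (μ-part ∧ weak λ-count `n ≤ k + e + 1`) ⟺ Mazur's main conjecture at the pair, granted Wuthrich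
  Thm. 16, Thm. 1.14, Stein–Wuthrich Thm. 6.1 (+ heights), GZK, modularity, Greenberg–Stevens — NO Prop. 3.10.

CONSEQUENCE (host RULING L111, HOME STATUS 2026-08-28T08:08:26Z): no re-registration; the tree now shows
that for row A10 «Prop. 3.10 OR Thm. 1.14 (either PUB) suffices as the cite-only parity input»; the
h310-free composition BY NAME is the companion file `…MazurMCOnCellBThm114Door`. The OPEN stubs 3′/4″
are untouched (class-wide open in print; jointly the crux). HONEST FRAMING: no main conjecture / BSD is
proved for any curve; Thm. 1.14 and the `PublishedInputs` conjuncts are hypotheses BY NAME; 0 cells /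
0 labels move. References: [GreenbergLNM1716] Thm. 1.14 (p. 68), Prop. 3.10 (p. 82); [Greenberg1989]
Thm. 2; [SteinWuthrich2013] Thm. 6.1 (p. 20), §4.2; [Wuthrich2014] Thm. 16 (p. 397);
[MazurTateTeitelbaum1986Invent] §I.17; [Washington1997] §7.1, §13.2.
-/

set_option autoImplicit false

-- `Summit.BirchSwinnertonDyer.BirchSwinnertonDyer.…`: the summit and its single sub-problem share a name.
set_option linter.dupNamespace false

noncomputable section

open scoped Classical MatrixGroups ModularForm

open PowerSeries CongruenceSubgroup WeierstrassCurve
  Literature.NumberTheory.EllipticCurves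
  Literature.NumberTheory.EllipticCurves.ModularForms
  Literature.NumberTheory.EllipticCurves.Rank1Residual
  Literature.NumberTheory.EllipticCurves.Wuthrich2014
  Literature.NumberTheory.EllipticCurves.Greenberg1999
  Literature.NumberTheory.EllipticCurves.SteinWuthrich2013
  Summit.BirchSwinnertonDyer.Rank1Residual
  Summit.BirchSwinnertonDyer.Rank1Residual.X1.MuLambda
  Summit.BirchSwinnertonDyer.Rank1Residual.X1.MuPart
  Summit.BirchSwinnertonDyer.Rank1Residual.X1.ParitySqueeze
  Summit.BirchSwinnertonDyer.Rank1Residual.X1.TamagawaSqueeze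
  Summit.BirchSwinnertonDyer.BirchSwinnertonDyer.Theorems.EisensteinPrimesX2AnalyticMuBound
  Summit.BirchSwinnertonDyer.BirchSwinnertonDyer.Theorems.EisensteinPrimesMazurMCOnCellBMuPartTight
  Summit.BirchSwinnertonDyer.BirchSwinnertonDyer.Theorems.EisensteinPrimesMazurMCOnCellBMuPartTightParity

namespace Summit.BirchSwinnertonDyer.BirchSwinnertonDyer.Theorems.EisensteinPrimesMazurMCOnCellBThm114Parity

variable {W : WeierstrassCurve ℚ} [W.IsElliptic] [W.IsGloballyMinimal] {p : ℕ} [Fact p.Prime]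

/-! ## §1. `ord_{T=0} f_E = 0` at an odd multiplicative prime of analytic rank `0` -/

/-- **`ord_{T=0} f_E = 0` at a rank-`0` odd multiplicative prime.** For `W/ℚ` globally minimal, `p ≠ 2`
of multiplicative reduction, `r_an(W) = 0`, the cyclotomic datum `(κ, γ)` matching the cyclotomic
variable, a finitely generated torsion dual datum `D` of `Sel_{p^∞}(E/ℚ_∞)` and any generator `f_E` of
`char_Λ D.X`: `f_E.order = 0`. Inputs BY NAME: Gross–Zagier–Kolyvagin (`hGZK`: rank `0`, `Ш` finite),
Stein–Wuthrich 2013 Thm. 6.1 split / non-split (`hJs`/`hJn`, clause (2): `ord_T f_E = rank ⟺ Schneider ∧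
Ш[p^∞] finite`) with THE §4.2 height (`hHs`/`hHn`); in rank `0` the `p`-adic regulator is `1`
(`padicRegulator_eq_one_of_finite`), so Schneider's non-degeneracy holds trivially. The Tate parameter is
the tree's (`nonempty_tateParameterData_iff`, `existsUnique_tateJ_eq_of_one_lt_norm`).
[cite: SteinWuthrich2013, Thm. 6.1 (p. 20) and §4.2 (p. 15)] [cite: GreenbergLNM1716, Thm. 4.1 (p. 85)] -/
theorem order_eq_zero_of_analyticRank_eq_zero
    (hJs : thm61_splitMultiplicative) (hJn : thm61_nonsplitMultiplicative)
    (hHs : exists_isSplitMultCanonical) (hHn : exists_isMultCanonical)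
    (hGZK : rank_eq_analyticRank_of_analyticRank_le_one)
    (hp2 : p ≠ 2) (hmult : W.HasMultiplicativeReductionAtPrime p) (hr : W.analyticRank = 0)
    {κ : ZpExtension ℚ p} {γ : Field.absoluteGaloisGroup ℚ}
    (hκ : κ.IsCyclotomic) (hγ : κ.IsTopGenerator γ) (hγ' : IsCyclotomicVariable p γ)
    (D : W.SelmerDualData κ γ) [Module.Finite (IwasawaAlgebra p) D.X] (hX : D.IsTorsion)
    {fE : IwasawaAlgebra p} (hchar : D.charIdeal = Ideal.span {fE}) : fE.order = 0 := by
  -- Gross–Zagier–Kolyvagin: rank `0`, `Ш` finite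
  obtain ⟨hrank, hfin⟩ := hGZK W (by rw [hr]; exact zero_le_one)
  have hr0 : W.mordellWeilRank = 0 := by rw [hrank, hr]
  haveI : Finite W.toAffine.Point := W.mordellWeilRank_eq_zero_iff_finite.mp hr0
  haveI : Finite W.sha := hfin
  have hfinp : Finite (AddCommGroup.primaryComponent W.sha p) := inferInstance
  by_cases hsplit : W.HasSplitMultiplicativeReductionAtPrime p
  · -- split: THE Tate parameter datum and THE §4.2 height; `Reg_p = 1`
    obtain ⟨Dq⟩ := (nonempty_tateParameterData_iff_holds (W := W) (p := p)).mpr hsplit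
    obtain ⟨Dh, hDh⟩ := hHs W p hp2 Dq
    have hSch : SchneiderConjecture Dh := by
      rw [SchneiderConjecture, padicRegulator_eq_one_of_finite W p Dh]
      exact one_ne_zero
    have hord := (thm61_splitMultiplicative.order_eq_iff hJs hp2 Dq hκ hγ hγ' D hX hDh hchar).mpr
      ⟨hSch, hfinp⟩
    rw [hord, hr0, Nat.cast_zero]
  · -- non-split: the Tate parameter from `‖j‖_p > 1` and THE §4.2 height; `Reg_p = 1`
    obtain ⟨q, ⟨hq0, hq1, hqj⟩, -⟩ := existsUnique_tateJ_eq_of_one_lt_norm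
      (one_lt_norm_j_of_hasMultiplicativeReductionAtPrime (W := W) (p := p) hmult)
    obtain ⟨Dh, hDh⟩ := hHn W p hp2 hmult hsplit q hq0 hq1 hqj
    have hSch : SchneiderConjecture Dh := by
      rw [SchneiderConjecture, padicRegulator_eq_one_of_finite W p Dh]
      exact one_ne_zero
    have hord := (thm61_nonsplitMultiplicative.order_eq_iff hJn hp2 hmult hsplit hq0 hq1 hqj hκ hγ hγ'
      D hX hDh hchar).mpr ⟨hSch, hfinp⟩
    rw [hord, hr0, Nat.cast_zero]

/-- **A generator of `char X` is nonzero at a rank-`0` odd multiplicative prime** (§1: `T`-order `0 < ⊤`). [cite: SteinWuthrich2013, Thm. 6.1 (p. 20)] -/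
theorem charGenerator_ne_zero_of_analyticRank_eq_zero
    (hJs : thm61_splitMultiplicative) (hJn : thm61_nonsplitMultiplicative)
    (hHs : exists_isSplitMultCanonical) (hHn : exists_isMultCanonical)
    (hGZK : rank_eq_analyticRank_of_analyticRank_le_one)
    (hp2 : p ≠ 2) (hmult : W.HasMultiplicativeReductionAtPrime p) (hr : W.analyticRank = 0)
    {κ : ZpExtension ℚ p} {γ : Field.absoluteGaloisGroup ℚ}
    (hκ : κ.IsCyclotomic) (hγ : κ.IsTopGenerator γ) (hγ' : IsCyclotomicVariable p γ)
    (D : W.SelmerDualData κ γ) [Module.Finite (IwasawaAlgebra p) D.X] (hX : D.IsTorsion)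
    {fE : IwasawaAlgebra p} (hchar : D.charIdeal = Ideal.span {fE}) : fE ≠ 0 := by
  intro h0
  have hord := order_eq_zero_of_analyticRank_eq_zero hJs hJn hHs hHn hGZK hp2 hmult hr hκ hγ hγ' D hX hchar
  rw [h0, PowerSeries.order_zero] at hord
  exact ENat.top_ne_zero hord

/-! ## §2. Thm. 1.14 ⟹ `λ(X)` is even at a rank-`0` odd multiplicative prime -/

/-- **Greenberg's Thm. 1.14 forces `λ(X(E/ℚ_∞))` EVEN at a rank-`0` odd multiplicative prime.** For
`W/ℚ` globally minimal, `p ≠ 2` multiplicative, `r_an(W) = 0`, `(κ, γ)` cyclotomic matching the cyclotomic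
variable and every finitely generated torsion dual datum `D`: `Even (λ(D.X))`. Proof: `char X = (f_E)` is
fixed by the Iwasawa involution (Thm. 1.14, `map_invol_charIdeal_eq_of_thm114`), hence
`ord_T f_E ≡ λ(X) (mod 2)` (`order_mod_two_eq_lambdaInvariant_of_map_invol_eq`), and `ord_T f_E = 0` (§1).
Named inputs: Thm. 1.14 (`h114`), Stein–Wuthrich Thm. 6.1 + heights, GZK.
[cite: GreenbergLNM1716, Thm. 1.14 (p. 68) and Prop. 3.10 (p. 82)] [cite: SteinWuthrich2013, Thm. 6.1 (p. 20)]
[cite: Washington1997, §7.1, §13.2] -/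
theorem even_lambdaInvariant_of_analyticRank_eq_zero_of_thm114
    (h114 : Greenberg1999_thm114_charIdeal_iota_invariant)
    (hJs : thm61_splitMultiplicative) (hJn : thm61_nonsplitMultiplicative)
    (hHs : exists_isSplitMultCanonical) (hHn : exists_isMultCanonical)
    (hGZK : rank_eq_analyticRank_of_analyticRank_le_one)
    (hp2 : p ≠ 2) (hmult : W.HasMultiplicativeReductionAtPrime p) (hr : W.analyticRank = 0)
    {κ : ZpExtension ℚ p} {γ : Field.absoluteGaloisGroup ℚ}
    (hκ : κ.IsCyclotomic) (hγ : κ.IsTopGenerator γ) (hγ' : IsCyclotomicVariable p γ)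
    (D : W.SelmerDualData κ γ) [Module.Finite (IwasawaAlgebra p) D.X] (hX : D.IsTorsion) :
    Even (lambdaInvariant p D.X) := by
  -- a generator `fE` of the (principal) characteristic ideal
  haveI : (Literature.NumberTheory.EllipticCurves.Module.charIdeal (IwasawaAlgebra p) D.X).IsPrincipal :=
    charIdeal_isPrincipal_holds p D.X
  obtain ⟨fE, hfE⟩ := Submodule.IsPrincipal.principal
    (Literature.NumberTheory.EllipticCurves.Module.charIdeal (IwasawaAlgebra p) D.X)
  have hchar : D.charIdeal = Ideal.span {fE} := hfE
  have hord := order_eq_zero_of_analyticRank_eq_zero hJs hJn hHs hHn hGZK hp2 hmult hr hκ hγ hγ' D hX hchar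
  have hfE0 : fE ≠ 0 :=
    charGenerator_ne_zero_of_analyticRank_eq_zero hJs hJn hHs hHn hGZK hp2 hmult hr hκ hγ hγ' D hX hchar
  -- Thm. 1.14, ideal form: `ι(char X) = char X`
  have hmap : Ideal.map (IwasawaAlgebra.invol p) D.charIdeal = D.charIdeal :=
    map_invol_charIdeal_eq_of_thm114 h114 W p (Or.inr hmult) κ γ hκ hγ D hX
  -- `ord_T fE ≡ λ(X) (mod 2)` and `ord_T fE = 0`
  obtain ⟨n, hn, hmod⟩ := order_mod_two_eq_lambdaInvariant_of_map_invol_eq hp2 D.X hX hfE0 hchar hmap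
  have hn0 : (n : ℕ∞) = 0 := by rw [← hn, hord]
  have hn0' : n = 0 := by exact_mod_cast hn0
  rw [hn0', Nat.zero_mod] at hmod
  exact Nat.even_iff.mpr hmod.symm

/-- **Prop. 3.10's conclusion at a rank-`0` odd multiplicative prime, from Thm. 1.14** — literally
`W.selmerCorank p % 2 = lambdaInvariant p D.X % 2` (the shape of the named fact
`Greenberg1999.prop310_selmerCorank_mod_two_eq_lambdaInvariant` at this pair): the corank is
`rank E(ℚ) = r_an = 0` (GZK, `Ш[p^∞]` finite) and `λ(X)` is even (§2).
[cite: GreenbergLNM1716, Prop. 3.10 (p. 82) and Thm. 1.14 (p. 68)] -/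
theorem selmerCorank_mod_two_eq_lambdaInvariant_mod_two_of_thm114
    (h114 : Greenberg1999_thm114_charIdeal_iota_invariant)
    (hJs : thm61_splitMultiplicative) (hJn : thm61_nonsplitMultiplicative)
    (hHs : exists_isSplitMultCanonical) (hHn : exists_isMultCanonical)
    (hGZK : rank_eq_analyticRank_of_analyticRank_le_one)
    (hp2 : p ≠ 2) (hmult : W.HasMultiplicativeReductionAtPrime p) (hr : W.analyticRank = 0)
    {κ : ZpExtension ℚ p} {γ : Field.absoluteGaloisGroup ℚ}
    (hκ : κ.IsCyclotomic) (hγ : κ.IsTopGenerator γ) (hγ' : IsCyclotomicVariable p γ)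
    (D : W.SelmerDualData κ γ) [Module.Finite (IwasawaAlgebra p) D.X] (hX : D.IsTorsion) :
    W.selmerCorank p % 2 = lambdaInvariant p D.X % 2 := by
  obtain ⟨hrank, hfin⟩ := hGZK W (by rw [hr]; exact zero_le_one)
  haveI : Finite W.sha := hfin
  have hfinp : Finite (AddCommGroup.primaryComponent W.sha p) := inferInstance
  have hev := even_lambdaInvariant_of_analyticRank_eq_zero_of_thm114 h114 hJs hJn hHs hHn hGZK hp2 hmult
    hr hκ hγ hγ' D hX
  rw [selmerCorank_eq_mordellWeilRank_of_finite_shaPrimary W p hfinp, hrank, hr, Nat.zero_mod,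
    (Nat.even_iff.mp hev)]

/-! ## §3. Route T, μ-tolerant, with an ABSTRACT algebraic parity -/

/-- **Route T at an odd multiplicative Eisenstein prime, μ-TOLERANT, WITH PARITY — the algebraic parity
as an abstract per-datum hypothesis.** Verbatim `…MuPartTightParity.mazurMainConjectureAt_of_muPart_of_lambdaCountParity`
(Wuthrich 2014 Thm. 16 `hWu`; `ϖ·L ≠ 0`; the μ-part; `λ_an = n`; `λ_alg ≥ k`; `n ≤ k + 1` and `n + r_an`
even at a non-split `p`, `n ≤ k + 2` and `n + r_an` odd at a split `p`), EXCEPT that the parity input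
`λ(X) ≡ r_an (mod 2)` — there Greenberg's Prop. 3.10 (`h310`) composed with GZK (`hGZK`) — is taken as the
hypothesis `hparAlg`; then `G = u·h·f_E` has `μ(h) = 0`, `λ(h) ≤ 1` even, so `h ∈ Λˣ` (proof adapted).
[cite: Wuthrich2014, Thm. 16 and §5 (p. 397)] [cite: GreenbergLNM1716, Prop. 3.10, Cor. 5.6 (proof, p. 136)]
[cite: GreenbergVatsal2000, p. 4 (after Thm. (1.2))] -/
theorem mazurMainConjectureAt_of_muPart_of_lambdaCountParity_of_algParity
    (hWu : thm16_charIdeal_dvd_multiplicative_of_reducible)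
    (W : WeierstrassCurve ℚ) [W.IsElliptic] [W.IsGloballyMinimal] (p : ℕ) [Fact p.Prime]
    (hp2 : p ≠ 2) (hmult : W.HasMultiplicativeReductionAtPrime p)
    (hred : ¬ W.HasIrreducibleModPGaloisRep p)
    (hparAlg : ∀ (κ : ZpExtension ℚ p) (γ : Field.absoluteGaloisGroup ℚ),
      κ.IsCyclotomic → κ.IsTopGenerator γ → IsCyclotomicVariable p γ →
      ∀ (D : W.SelmerDualData κ γ) [Module.Finite (IwasawaAlgebra p) D.X], D.IsTorsion →
        lambdaInvariant p D.X % 2 = W.analyticRank % 2)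
    (hL0 : ∃ m : ℕ, X2.AnalyticMuLE W p m)
    (hμ : ∀ (κ : ZpExtension ℚ p) (γ : Field.absoluteGaloisGroup ℚ),
      κ.IsCyclotomic → κ.IsTopGenerator γ → IsCyclotomicVariable p γ →
      ∀ {N : ℕ} [NeZero N] (f : CuspForm (Gamma0 N) 2), IsNewformOf W f →
      ∀ (ϖ : ℚ), (ϖ : ℝ) * W.realPeriodRat = plusPeriod f →
      ∀ (L : PowerSeries ℚ_[p]),
        (W.HasSplitMultiplicativeReductionAtPrime p → IsSplitMultPAdicLFunctionOf f p L) →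
        (¬ W.HasSplitMultiplicativeReductionAtPrime p → IsMultPAdicLFunctionOf f p (-1) L) →
      ∀ (D : W.SelmerDualData κ γ) (g G : IwasawaAlgebra p), D.charIdeal = Ideal.span {g} →
        iwasawaToPowerSeries p G = PowerSeries.C ((ϖ : ℚ) : ℚ_[p]) * L → mu G ≤ mu g)
    {n k : ℕ} (hlam : X2.AnalyticLambdaEq W p n) (halg : AlgebraicLambdaGE W p k)
    (hkN : ¬ W.HasSplitMultiplicativeReductionAtPrime p → n ≤ k + 1 ∧ Even (n + W.analyticRank))
    (hkS : W.HasSplitMultiplicativeReductionAtPrime p → n ≤ k + 2 ∧ Odd (n + W.analyticRank)) :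
    X2.MazurMainConjectureAt W p := by
  -- adapted from `…MuPartTightParity.mazurMainConjectureAt_of_muPart_of_lambdaCountParity` (-w2 g2, p611137)
  intro κ γ hκ hγ hγ' N _ f hf D ϖ hϖ
  haveI : Module.Finite (IwasawaAlgebra p) D.X := D.module_finite_holds hγ
  obtain ⟨m, hLm⟩ := hL0
  -- Wuthrich Thm. 16 at this datum; a generator `fE` of the characteristic ideal
  obtain ⟨hX, hKns, hKs⟩ := hWu W p hp2 hmult hred hκ hγ hγ' hf D ϖ hϖ
  haveI : (Literature.NumberTheory.EllipticCurves.Module.charIdeal (IwasawaAlgebra p) D.X).IsPrincipal :=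
    charIdeal_isPrincipal_holds p D.X
  obtain ⟨fE, hfE⟩ := Submodule.IsPrincipal.principal
    (Literature.NumberTheory.EllipticCurves.Module.charIdeal (IwasawaAlgebra p) D.X)
  have hchar : D.charIdeal = Ideal.span {fE} := hfE
  -- the lower bound and the (abstract) parity of `λ(fE) = λ(X)`
  have hkfE : fE ≠ 0 → k ≤ lam fE ∧ lam fE % 2 = W.analyticRank % 2 := fun hfE0 ↦ by
    rw [lam_generator_eq_lambdaInvariant D.X hX hfE0 hchar]
    exact ⟨halg κ γ hκ hγ D hX, hparAlg κ γ hκ hγ hγ' D hX⟩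
  -- how the data at `G = u · (h · fE)` finish (`u = T` or `u = 1`)
  have finish : ∀ (u h : IwasawaAlgebra p) (e : ℕ) (L : PowerSeries ℚ_[p]), u ≠ 0 → lam u = e →
      mu u = 0 →
      (W.HasSplitMultiplicativeReductionAtPrime p → IsSplitMultPAdicLFunctionOf f p L) →
      (¬ W.HasSplitMultiplicativeReductionAtPrime p → IsMultPAdicLFunctionOf f p (-1) L) →
      iwasawaToPowerSeries p (u * (h * fE)) = PowerSeries.C ((ϖ : ℚ) : ℚ_[p]) * L →
      lam (u * (h * fE)) = n → n ≤ k + e + 1 → Even (n + e + W.analyticRank) → IsUnit h := by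
    intro u h e L hu0 hlu hμu hLs hLn hG hlG hnk hpar
    obtain ⟨k', hk'⟩ := hLm f hf ϖ hϖ L hLs hLn
    have hL0' : PowerSeries.C ((ϖ : ℚ) : ℚ_[p]) * L ≠ 0 := X2.ne_zero_of_lt_norm_coeff hk'
    have hG0 : u * (h * fE) ≠ 0 := by
      intro h0; apply hL0'; rw [← hG, h0, map_zero]
    have hh0 : h ≠ 0 := fun h0 ↦ hG0 (by rw [h0, zero_mul, mul_zero])
    have hfE0 : fE ≠ 0 := fun h0 ↦ hG0 (by rw [h0, mul_zero, mul_zero])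
    -- μ-part: `μ(u·h·fE) ≤ μ(fE)`, so `μ(h) = 0`
    have hμG : mu (u * (h * fE)) ≤ mu fE := hμ κ γ hκ hγ hγ' f hf ϖ hϖ L hLs hLn D fE _ hchar hG
    rw [mu_mul hu0 (mul_ne_zero hh0 hfE0), mu_mul hh0 hfE0, hμu] at hμG
    have hμh : mu h = 0 := by omega
    -- parity λ-count: `e + λ(h) + λ(fE) = n ≤ k + e + 1 ≤ λ(fE) + e + 1`, `λ(h)` even, so `0`
    rw [lam_mul hu0 (mul_ne_zero hh0 hfE0), lam_mul hh0 hfE0, hlu] at hlG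
    obtain ⟨hk, hmod⟩ := hkfE hfE0
    have hlh : lam h = 0 := by
      rcases Nat.even_or_odd (lam fE) with hev | hod
      · rw [Nat.even_iff] at hev
        rcases hpar with ⟨j, hj⟩
        omega
      · rw [Nat.odd_iff] at hod
        rcases hpar with ⟨j, hj⟩
        omega
    exact (isUnit_iff_mu_eq_zero_and_lam_eq_zero h).mpr ⟨hh0, hμh, hlh⟩
  refine ⟨hX, fE, hchar, fun hsplit L hL => ?_, fun hns L hL => ?_⟩
  · -- SPLIT `p`: `λ(T·h·fE) = n ≤ k + 2`, `n + r_an` odd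
    obtain ⟨hk2, hodd⟩ := hkS hsplit
    obtain ⟨g, hgmem, hιg⟩ := hKs hsplit L hL
    have hgmem' : g ∈ Ideal.span {fE} := by rw [← hchar]; exact hgmem
    obtain ⟨h, hgh⟩ := Ideal.mem_span_singleton'.mp hgmem'
    have hG : iwasawaToPowerSeries p (PowerSeries.X * (h * fE)) =
        PowerSeries.C ((ϖ : ℚ) : ℚ_[p]) * L := by rw [hgh]; exact hιg
    have hlG : lam (PowerSeries.X * (h * fE)) = n :=
      hlam f hf ϖ hϖ L (fun _ ↦ hL) (fun hns ↦ absurd hsplit hns) _ hG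
    have hpar : Even (n + 1 + W.analyticRank) := by
      rw [add_right_comm]; exact hodd.add_one
    have hunit : IsUnit h := finish PowerSeries.X h 1 L PowerSeries.X_ne_zero X2.lam_X
      X2.mu_X_eq_zero_and_pfree_X.1 (fun _ ↦ hL) (fun hns ↦ absurd hsplit hns) hG hlG (by omega) hpar
    refine ⟨hunit.unit, ?_⟩
    rw [IsUnit.unit_spec, show (PowerSeries.X : IwasawaAlgebra p) * fE * h = PowerSeries.X * g by
      rw [← hgh]; ring]
    exact hιg
  · -- NON-SPLIT `p`: `λ(1·h·fE) = n ≤ k + 1`, `n + r_an` even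
    obtain ⟨hk1, heven⟩ := hkN hns
    obtain ⟨g, hgmem, hιg⟩ := hKns hns L hL
    have hgmem' : g ∈ Ideal.span {fE} := by rw [← hchar]; exact hgmem
    obtain ⟨h, hgh⟩ := Ideal.mem_span_singleton'.mp hgmem'
    have hG : iwasawaToPowerSeries p (1 * (h * fE)) = PowerSeries.C ((ϖ : ℚ) : ℚ_[p]) * L := by
      rw [one_mul, hgh]; exact hιg
    have hlG : lam (1 * (h * fE)) = n :=
      hlam f hf ϖ hϖ L (fun hsplit ↦ absurd hsplit hns) (fun _ ↦ hL) _ hG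
    have hpar : Even (n + 0 + W.analyticRank) := by rw [add_zero]; exact heven
    have hunit : IsUnit h := finish 1 h 0 L one_ne_zero (lam_eq_zero_of_isUnit isUnit_one)
      (X2.mu_eq_zero_of_isUnit isUnit_one) (fun hsplit ↦ absurd hsplit hns) (fun _ ↦ hL) hG hlG
      (by omega) hpar
    refine ⟨hunit.unit, ?_⟩
    rw [IsUnit.unit_spec, show fE * h = g by rw [← hgh]; ring]
    exact hιg

/-! ## §4. The v4 currency of line `mudescent` at an X2b pair, from Thm. 1.14 instead of Prop. 3.10 -/

/-- **Route T, μ-tolerant, WEAK λ-count, at `r_an = 0`, with Thm. 1.14 as the parity input.** For `W/ℚ`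
globally minimal, `p ≠ 2` multiplicative, `E[p]` reducible, `r_an = 0`: Wuthrich Thm. 16 (`hWu`),
Greenberg Thm. 1.14 (`h114`), Stein–Wuthrich Thm. 6.1 + heights (`hJs hJn hHs hHn`), GZK (`hGZK`),
modularity (`hpar`) and Greenberg–Stevens (`hGS`) BY NAME, plus the μ-part and the WEAK λ-count
(`λ_an = n`, `λ_alg ≥ k`, `n ≤ k + 1` non-split / `n ≤ k + 2` split) give `X2.MazurMainConjectureAt W p`.
The parity of `n` is the kernel theorem `X2.analyticLambdaEq_parity` (Mazur–Tate–Teitelbaum functional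
equation; `ϖ·L ≠ 0` at `r_an = 0`), the parity of `λ_alg` is §2. NO Prop. 3.10.
[cite: GreenbergLNM1716, Thm. 1.14 (p. 68)] [cite: Wuthrich2014, Thm. 16 (p. 397)]
[cite: MazurTateTeitelbaum1986Invent, §I.17–I.18] [cite: SteinWuthrich2013, Thm. 6.1 (p. 20)] -/
theorem mazurMainConjectureAt_of_muPart_of_lambdaCountWeak_of_thm114
    (hWu : thm16_charIdeal_dvd_multiplicative_of_reducible)
    (h114 : Greenberg1999_thm114_charIdeal_iota_invariant)
    (hJs : thm61_splitMultiplicative) (hJn : thm61_nonsplitMultiplicative)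
    (hHs : exists_isSplitMultCanonical) (hHn : exists_isMultCanonical)
    (hGZK : rank_eq_analyticRank_of_analyticRank_le_one)
    (hpar : nonempty_modularParametrizationData) (hGS : greenberg_stevens (W := W) (p := p))
    (hp2 : p ≠ 2) (hmult : W.HasMultiplicativeReductionAtPrime p)
    (hred : ¬ W.HasIrreducibleModPGaloisRep p) (hr0 : W.analyticRank = 0)
    (hμ : ∀ (κ : ZpExtension ℚ p) (γ : Field.absoluteGaloisGroup ℚ),
      κ.IsCyclotomic → κ.IsTopGenerator γ → IsCyclotomicVariable p γ →
      ∀ {N : ℕ} [NeZero N] (f : CuspForm (Gamma0 N) 2), IsNewformOf W f →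
      ∀ (ϖ : ℚ), (ϖ : ℝ) * W.realPeriodRat = plusPeriod f →
      ∀ (L : PowerSeries ℚ_[p]),
        (W.HasSplitMultiplicativeReductionAtPrime p → IsSplitMultPAdicLFunctionOf f p L) →
        (¬ W.HasSplitMultiplicativeReductionAtPrime p → IsMultPAdicLFunctionOf f p (-1) L) →
      ∀ (D : W.SelmerDualData κ γ) (g G : IwasawaAlgebra p), D.charIdeal = Ideal.span {g} →
        iwasawaToPowerSeries p G = PowerSeries.C ((ϖ : ℚ) : ℚ_[p]) * L → mu G ≤ mu g)
    {n k : ℕ} (hlam : X2.AnalyticLambdaEq W p n) (halg : AlgebraicLambdaGE W p k)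
    (hkN : ¬ W.HasSplitMultiplicativeReductionAtPrime p → n ≤ k + 1)
    (hkS : W.HasSplitMultiplicativeReductionAtPrime p → n ≤ k + 2) :
    X2.MazurMainConjectureAt W p := by
  have hL0 : ∃ m : ℕ, X2.AnalyticMuLE W p m := exists_analyticMuLE_of_analyticRank_eq_zero hpar hp2 hGS hr0
  obtain ⟨m, hμm⟩ := hL0
  obtain ⟨hev, hod⟩ := X2.analyticLambdaEq_parity hWu hpar W p hp2 hmult hred hμm hlam
  refine mazurMainConjectureAt_of_muPart_of_lambdaCountParity_of_algParity hWu W p hp2 hmult hred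
    (fun κ γ hκ hγ hγ' D _ hX ↦ ?_) ⟨m, hμm⟩ hμ hlam halg (fun hns ↦ ⟨hkN hns, hev hns⟩)
    (fun hs ↦ ⟨hkS hs, hod hs⟩)
  rw [hr0, Nat.zero_mod]
  exact Nat.even_iff.mp (even_lambdaInvariant_of_analyticRank_eq_zero_of_thm114 h114 hJs hJn hHs hHn
    hGZK hp2 hmult hr0 hκ hγ hγ' D hX)

/-- **On sub-cell X2b: Mazur's main conjecture at the pair ⟺ μ-part ∧ the WEAK λ-count — the v4 currency
of line `mudescent` — granted Thm. 1.14 in place of Prop. 3.10.** Same statement as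
`…MudescentV4.cellB_mazurMainConjectureAt_iff_muPart_and_lambdaCountWeak` with `h310` replaced by
`h114 hJs hJn hHs hHn`. `→`: the TIGHT converse of `…MuPartTight` (`cellB_mazurMainConjectureAt_iff_muPart_and_lambdaCount`,
no parity fact at all); `←`: `mazurMainConjectureAt_of_muPart_of_lambdaCountWeak_of_thm114`.
[cite: GreenbergLNM1716, Thm. 1.14 (p. 68)] [cite: Wuthrich2014, Thm. 16 (p. 397)] [cite: MazurTateTeitelbaum1986Invent, §I.17] -/
theorem cellB_mazurMainConjectureAt_iff_muPart_and_lambdaCountWeak_of_thm114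
    (hWu : thm16_charIdeal_dvd_multiplicative_of_reducible)
    (h114 : Greenberg1999_thm114_charIdeal_iota_invariant)
    (hJs : thm61_splitMultiplicative) (hJn : thm61_nonsplitMultiplicative)
    (hHs : exists_isSplitMultCanonical) (hHn : exists_isMultCanonical)
    (hGZK : rank_eq_analyticRank_of_analyticRank_le_one)
    (hpar : nonempty_modularParametrizationData) (hGS : greenberg_stevens (W := W) (p := p))
    (hc : X2.CellB W p) :
    X2.MazurMainConjectureAt W p ↔
      ((∀ (κ : ZpExtension ℚ p) (γ : Field.absoluteGaloisGroup ℚ),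
        κ.IsCyclotomic → κ.IsTopGenerator γ → IsCyclotomicVariable p γ →
        ∀ {N : ℕ} [NeZero N] (f : CuspForm (Gamma0 N) 2), IsNewformOf W f →
        ∀ (ϖ : ℚ), (ϖ : ℝ) * W.realPeriodRat = plusPeriod f →
        ∀ (L : PowerSeries ℚ_[p]),
          (W.HasSplitMultiplicativeReductionAtPrime p → IsSplitMultPAdicLFunctionOf f p L) →
          (¬ W.HasSplitMultiplicativeReductionAtPrime p → IsMultPAdicLFunctionOf f p (-1) L) →
        ∀ (D : W.SelmerDualData κ γ) (g G : IwasawaAlgebra p), D.charIdeal = Ideal.span {g} →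
          iwasawaToPowerSeries p G = PowerSeries.C ((ϖ : ℚ) : ℚ_[p]) * L → mu G ≤ mu g) ∧
      ∃ n k : ℕ, X2.AnalyticLambdaEq W p n ∧ AlgebraicLambdaGE W p k ∧
        (¬ W.HasSplitMultiplicativeReductionAtPrime p → n ≤ k + 1) ∧
        (W.HasSplitMultiplicativeReductionAtPrime p → n ≤ k + 2)) := by
  have hp2 : p ≠ 2 := hc.2.1.1
  have hred : ¬ W.HasIrreducibleModPGaloisRep p := hc.2.1.2.1
  have hmult : W.HasMultiplicativeReductionAtPrime p := hc.2.1.2.2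
  have hr0 : W.analyticRank = 0 := hc.1
  constructor
  · intro hMC
    obtain ⟨hμ', n, k, hlam, halg, hkN, hkS⟩ :=
      (cellB_mazurMainConjectureAt_iff_muPart_and_lambdaCount hWu hpar hGS hc).mp hMC
    exact ⟨hμ', n, k, hlam, halg, fun hns ↦ by have := hkN hns; omega, fun hs ↦ by have := hkS hs; omega⟩
  · rintro ⟨hμ', n, k, hlam, halg, hkN, hkS⟩
    exact mazurMainConjectureAt_of_muPart_of_lambdaCountWeak_of_thm114 hWu h114 hJs hJn hHs hHn hGZK hpar
      hGS hp2 hmult hred hr0 hμ' hlam halg hkN hkS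

end Summit.BirchSwinnertonDyer.BirchSwinnertonDyer.Theorems.EisensteinPrimesMazurMCOnCellBThm114Parity

end
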